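import Summits.Schanuel.Schanuel.Theorems.ZilberEacConicPolyFibre
import Summits.Schanuel.Schanuel.Theorems.ZilberEacHyperellipticNorm
import HarnessLib

/-!
# Arbitrary base branches, L (a): the sheet relation over a CONIC — transcendence and the
# meromorphic normal form of the fibre value `A(x₀) + x₁B(x₀)`

HONEST FRAMING.  Cell `pub-schanuel` (Zilber's Exponential-Algebraic Closedness, case ladder;
host summit Schanuel), seat 2, gen 30.  Over a conic `C : x₁² = P(x₀)`, `P = x₀² + p₁x₀ + p₀`
monic with simple roots (`c = p₀ − p₁²/4 ≠ 0`), the general polynomial fibre is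
`y₀ = A(x₀) + x₁B(x₀)` (file XLIX).  Along the place `x₁ − x₀ → p₁/2` the exponential points are
`x₀ = 1/s` with `e^{1/s} = A(1/s) + x₁(s)B(1/s) = ψ(s)s^{L}` (`ψ(0) ≠ 0`, `L ∈ ℤ`: the meromorphic
normal form **`exists_sheetFibre_normalForm`**, by the isolated-zeros principle — the fibre value is
not identically zero on `C` because `A² − PB² ≠ 0`), supplied by the pole-fibre labels of file XXXI,
and `y₁ = e^{x₁} = (A + x₁B)(1/s)·e^{p₁/2}·e^{η(s)}` — THEOREM T with two poles (file XLVI).  The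
transcendence of this relation (**`conic_exp_relation_transcendental_sheet`**) is reduced to the
constant-fibre transcendence of file XLIII by the NORM over the two sheets (file XLIX): a relation
`H(x₀, (A + x₁B)θ'e^{η}) = 0` forces `Hn(x₀, θ'e^{η}) = 0` with `Hn ≠ 0`.  Results:
**`unprojectedDensityQuestion_conic_sheetFibre`** — for every `(A, B) ≠ (0, 0)` the surface
`{x₁² − P(x₀) = 0, y₀ = A(x₀) + x₁B(x₀)}` is in Mantova–Masser's case AND has Zariski-dense
exponential points; **`unprojectedDensityQuestion_conic_polyFibre`** — the same for `y₀ = R(x₀, x₁)`,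
`R` any polynomial not vanishing identically on `C`; in particular `y₀ = x₁` over every conic
(**`unprojectedDensityQuestion_conic_fibre_x₁`**) and the unit hyperbola with `y₀ = x₁`,
`y₀ = x₀ + x₁`.  This closes the polynomial fibres over the last pair `(k, deg P) = (2, 2)`.
Decided instances of an OPEN question (Mantova–Masser, PLMS 2024 §1 p. 5); EC(3,2) OPEN; NOT
Schanuel's conjecture (neither used nor implied); EAC ⇏ SC.
-/

noncomputable section

open Filter Topology Set Complex Polynomial
open Literature.NumberTheory.Transcendental Literature.ModelTheory.Zilber
open Literature.ModelTheory.ExponentialFields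

set_option linter.dupNamespace false

namespace Summit.Schanuel.Schanuel.Theorems

/-! ## Part A. The sheet at infinity and the transcendence of the sheet relation -/

/-- **Transcendence of the sheet relation.**  `η` the small branch of the conic
(`uη² + (2 + p₁u)η − cu = 0`, `c = p₀ − p₁²/4 ≠ 0`), `θ' ≠ 0`, `A² − PB² ≠ 0`: no nonzero
`H ∈ ℂ[x][y]` has `H(1/u, (A(1/u) + x₁(u)B(1/u))·θ'e^{η(u)}) = 0` for all small `u ≠ 0`
(`x₁(u) = 1/u + p₁/2 + η(u)`).  Proof: the sheet norm `Hn` of file XLIX then satisfies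
`Hn(1/u, θ'e^{η(u)}) = 0`, contradicting file XLIII. [folklore] (new in this form) -/
theorem conic_exp_relation_transcendental_sheet {p₁ p₀ θ' : ℂ} (hc : p₀ - p₁ ^ 2 / 4 ≠ 0)
    (hθ' : θ' ≠ 0) {η : ℂ → ℂ} (hηan : AnalyticAt ℂ η 0) (hη0 : η 0 = 0)
    (hηQ : ∀ᶠ u in 𝓝 (0 : ℂ), u * η u ^ 2 + (2 + p₁ * u) * η u - (p₀ - p₁ ^ 2 / 4) * u = 0)
    {P A B : ℂ[X]} (hPev : ∀ x : ℂ, P.eval x = x ^ 2 + p₁ * x + p₀)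
    (hN : A ^ 2 - P * B ^ 2 ≠ 0) (H : ℂ[X][X]) (hH0 : H ≠ 0) :
    ¬ ∀ᶠ u in 𝓝[≠] (0 : ℂ), (H.map (Polynomial.evalRingHom u⁻¹)).eval
      ((A.eval u⁻¹ + (u⁻¹ + p₁ / 2 + η u) * B.eval u⁻¹) * (θ' * Complex.exp (η u))) = 0 := by
  intro h
  obtain ⟨Hn, hHn⟩ := exists_sheetNorm P A B H
  have hHn0 : Hn ≠ 0 := sheetNorm_ne_zero P A B hN H hH0 hHn
  refine conic_exp_relation_transcendental hc hθ' hηan hη0 hηQ Hn hHn0 ?_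
  filter_upwards [h, eventually_nhdsWithin_of_eventually_nhds hηQ, self_mem_nhdsWithin] with u hu hq
    hu0
  have hz := conic_sheet_sq hPev hu0 hq
  rw [hHn _ _ _ hz, hu, zero_mul]

/-! ## Part B. The meromorphic normal form of the fibre value along the sheet -/

/-- `A(1/s) = Ã(s)·s^{-deg A}` with `Ã` the reversed polynomial (`s ≠ 0`). [folklore] -/
theorem eval_inv_eq_reflect_mul_zpow (A : ℂ[X]) {s : ℂ} (hs : s ≠ 0) :
    A.eval s⁻¹ = Polynomial.aeval s (A.reflect A.natDegree) * s ^ (-(A.natDegree : ℤ)) := by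
  haveI : Invertible s⁻¹ := invertibleOfNonzero (inv_ne_zero hs)
  have h := Polynomial.eval₂_reflect_mul_pow (RingHom.id ℂ) s⁻¹ A.natDegree A le_rfl
  rw [invOf_eq_inv, inv_inv] at h
  simp only [Polynomial.eval₂_id] at h
  rw [Polynomial.coe_aeval_eq_eval, zpow_neg, zpow_natCast, ← inv_pow]
  exact h.symm

/-- The reversed polynomial does not vanish at `0` (`A ≠ 0`). [folklore] -/
theorem aeval_reflect_zero_ne_zero {A : ℂ[X]} (hA : A ≠ 0) :
    Polynomial.aeval (0 : ℂ) (A.reflect A.natDegree) ≠ 0 := by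
  simp only [Polynomial.coe_aeval_eq_eval, ← Polynomial.coeff_zero_eq_eval_zero,
    Polynomial.coeff_reflect, Polynomial.revAt_le (Nat.zero_le _), Nat.sub_zero]
  exact Polynomial.leadingCoeff_ne_zero.2 hA

/-- **Meromorphic normal form of the fibre value along the sheet.**  With `η` the small branch
and `A² − PB² ≠ 0`: `A(1/s) + x₁(s)B(1/s) = ψ(s)s^{L}` for small `s ≠ 0`, with `ψ` analytic,
`ψ(0) ≠ 0`, `L ∈ ℤ` (isolated zeros: the value is not identically zero, since its product with the
conjugate sheet is `(A² − PB²)(1/s) ≠ 0`). [folklore] -/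
theorem exists_sheetFibre_normalForm {p₁ p₀ : ℂ} {η : ℂ → ℂ} (hηan : AnalyticAt ℂ η 0)
    (hηQ : ∀ᶠ u in 𝓝 (0 : ℂ), u * η u ^ 2 + (2 + p₁ * u) * η u - (p₀ - p₁ ^ 2 / 4) * u = 0)
    {P A B : ℂ[X]} (hPev : ∀ x : ℂ, P.eval x = x ^ 2 + p₁ * x + p₀)
    (hN : A ^ 2 - P * B ^ 2 ≠ 0) :
    ∃ (ψ : ℂ → ℂ) (L : ℤ), AnalyticAt ℂ ψ 0 ∧ ψ 0 ≠ 0 ∧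
      ∀ᶠ s in 𝓝[≠] (0 : ℂ),
        A.eval s⁻¹ + (s⁻¹ + p₁ / 2 + η s) * B.eval s⁻¹ = ψ s * s ^ L := by
  set a : ℕ := A.natDegree with ha
  set b : ℕ := B.natDegree with hb
  set At : ℂ → ℂ := fun s => Polynomial.aeval s (A.reflect a) with hAt
  set Bt : ℂ → ℂ := fun s => Polynomial.aeval s (B.reflect b) with hBt
  have hAtan : AnalyticAt ℂ At 0 := analyticAt_id.aeval_polynomial _
  have hBtan : AnalyticAt ℂ Bt 0 := analyticAt_id.aeval_polynomial _
  set g : ℂ → ℂ := fun s =>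
    s ^ (b + 1) * At s + s ^ a * ((1 + p₁ / 2 * s + s * η s) * Bt s) with hg
  have hid : AnalyticAt ℂ (fun s : ℂ => s) 0 := analyticAt_id
  have h1 : AnalyticAt ℂ (fun s : ℂ => (1 + p₁ / 2 * s + s * η s) * Bt s) 0 :=
    ((analyticAt_const.add (analyticAt_const.mul hid)).add (hid.mul hηan)).mul hBtan
  have hgan : AnalyticAt ℂ g 0 := ((hid.pow (b + 1)).mul hAtan).add ((hid.pow a).mul h1)
  -- `f(s) = g(s)·s^{-(a+b+1)}` for `s ≠ 0`
  have hgf : ∀ s : ℂ, s ≠ 0 → A.eval s⁻¹ + (s⁻¹ + p₁ / 2 + η s) * B.eval s⁻¹ =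
      g s * s ^ (-((a + b + 1 : ℕ) : ℤ)) := by
    intro s hs
    rw [eval_inv_eq_reflect_mul_zpow A hs, eval_inv_eq_reflect_mul_zpow B hs]
    simp only [hg, hAt, hBt, ← ha, ← hb, zpow_neg, zpow_natCast]
    field_simp
    ring
  -- `g` is not identically zero near `0`
  have hg_ne : ¬ ∀ᶠ s in 𝓝 (0 : ℂ), g s = 0 := by
    intro hg0
    set N : ℂ[X] := A ^ 2 - P * B ^ 2 with hNdef
    have hNt0 : Polynomial.aeval (0 : ℂ) (N.reflect N.natDegree) ≠ 0 := aeval_reflect_zero_ne_zero hN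
    have hNtan : AnalyticAt ℂ (fun s : ℂ => Polynomial.aeval s (N.reflect N.natDegree)) 0 :=
      analyticAt_id.aeval_polynomial _
    have hNt : ∀ᶠ s in 𝓝 (0 : ℂ), Polynomial.aeval s (N.reflect N.natDegree) ≠ 0 :=
      hNtan.continuousAt.eventually_ne hNt0
    obtain ⟨s, hs0, hgs, hqs, hNs⟩ := ((eventually_mem_nhdsWithin :
        ∀ᶠ s in 𝓝[≠] (0 : ℂ), s ∈ ({(0 : ℂ)}ᶜ : Set ℂ)).and
      ((eventually_nhdsWithin_of_eventually_nhds hg0).and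
        ((eventually_nhdsWithin_of_eventually_nhds hηQ).and
          (eventually_nhdsWithin_of_eventually_nhds hNt)))).exists
    have hs0' : s ≠ 0 := hs0
    have hf0 : A.eval s⁻¹ + (s⁻¹ + p₁ / 2 + η s) * B.eval s⁻¹ = 0 := by
      rw [hgf s hs0', hgs, zero_mul]
    have hz := conic_sheet_sq hPev hs0' hqs
    have hNev : N.eval s⁻¹ = 0 := by
      have hA' : A.eval s⁻¹ = -((s⁻¹ + p₁ / 2 + η s) * B.eval s⁻¹) := eq_neg_of_add_eq_zero_left hf0
      rw [hNdef, ← sheet_mul_sheet_eq P A B hz, hA']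
      ring
    rw [eval_inv_eq_reflect_mul_zpow N hs0'] at hNev
    exact (mul_ne_zero hNs (zpow_ne_zero _ hs0')) hNev
  obtain ⟨m, ψ, hψan, hψ0, hgψ⟩ := hgan.exists_eventuallyEq_pow_smul_nonzero_iff.2 hg_ne
  refine ⟨ψ, (m : ℤ) - ((a + b + 1 : ℕ) : ℤ), hψan, hψ0, ?_⟩
  filter_upwards [eventually_nhdsWithin_of_eventually_nhds hgψ, self_mem_nhdsWithin] with s h2
    hs0
  have hs0' : s ≠ 0 := hs0
  rw [hgf s hs0', h2, sub_zero, smul_eq_mul, zpow_sub₀ hs0', zpow_natCast, zpow_neg, zpow_natCast]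
  rw [div_eq_mul_inv]
  ring

/-- **Normal form of the coordinate `x₁` along the sheet** (`P ≠ 0`): `x₁(s) = 1/s + p₁/2 + η(s) =
ψ(s)s^{L}` with `ψ` analytic, `ψ(0) ≠ 0` (the case `A = 0`, `B = 1` of `exists_sheetFibre_normalForm`).
[folklore] -/
theorem exists_sheet_x₁_normalForm {p₁ p₀ : ℂ} {η : ℂ → ℂ} (hηan : AnalyticAt ℂ η 0)
    (hηQ : ∀ᶠ u in 𝓝 (0 : ℂ), u * η u ^ 2 + (2 + p₁ * u) * η u - (p₀ - p₁ ^ 2 / 4) * u = 0)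
    {P : ℂ[X]} (hPev : ∀ x : ℂ, P.eval x = x ^ 2 + p₁ * x + p₀) (hP0 : P ≠ 0) :
    ∃ (ψ : ℂ → ℂ) (L : ℤ), AnalyticAt ℂ ψ 0 ∧ ψ 0 ≠ 0 ∧
      ∀ᶠ s in 𝓝[≠] (0 : ℂ), s⁻¹ + p₁ / 2 + η s = ψ s * s ^ L := by
  have hN : (0 : ℂ[X]) ^ 2 - P * 1 ^ 2 ≠ 0 := by simpa using hP0
  obtain ⟨ψ, L, hψan, hψ0, hf⟩ := exists_sheetFibre_normalForm (A := 0) (B := 1) hηan hηQ hPev hN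
  refine ⟨ψ, L, hψan, hψ0, ?_⟩
  filter_upwards [hf] with s hs
  simpa using hs

end Summit.Schanuel.Schanuel.Theorems

end
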